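import Literature.NumberTheory.EllipticCurves.NewformsLevelRaising
import Literature.NumberTheory.EllipticCurves.ModularityVersionAp
import HarnessLib

/-!
# The Hecke operator `T_p = U_p` at a prime `p` dividing the level, on the old forms `ι_d f` (proofs only)

A *proofs* file (theorems only: no definition, no named fact): the action of `T_p` at level `Γ₀(N)`, for a prime
`p ∣ N` (so `T_p = U_p`, `a_n(T_p h) = a_{pn}(h)`, the tree's `qExpansion_coeff_heckeT_holds`), on the old forms
`ι_d f`, `f ∈ S_k(Γ₀(M))`, `M d ∣ N` (`ι_d f = Σ a_n q^{dn}`, the tree's `iota` / `qExpansion_coeff_iota` of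
`NewformsLevelRaising`), read off from `q`-expansions (Atkin–Lehner 1970, Lemma 15; Diamond–Shurman Prop. 5.2.2 (a),
§5.7 and, for a normalised newform `f`, the recursion `a_{pm} = a_p a_m − 𝟙_{p∤M} p^{k−1} 𝟙_{p∣m} a_{m/p}`, Prop. 5.8.5 —
the tree's `IsNewform0.cuspCoeff_prime_mul`):
* `heckeT_iota_of_dvd` — `p ∣ d`: `T_p ι_{d'p} f = ι_{d'} f` (any `f`);
* `heckeT_iota_of_not_dvd_of_not_dvd_level` — `p ∤ d`, `p ∤ M`, `f` a normalised newform: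
  `T_p ι_d f = a_p(f) ι_d f − p^{k−1} ι_{dp} f`;
* `heckeT_iota_of_not_dvd_of_dvd_level` — `p ∤ d`, `p ∣ M`, `f` a normalised newform: `T_p ι_d f = a_p(f) ι_d f`.
With `degeneracyMap0 M N d k = d^{k−1} ι_d` (`degeneracyMap0_eq_smul_iota`) these are, in weight `2`,
`U_p δ_{d'p} = p δ_{d'}`, `U_p δ_d = a_p δ_d − δ_{dp}` (`p ∤ dM`), `U_p δ_d = a_p δ_d` (`p ∣ M`): the `U_p`-bookkeeping
of old classes used in level raising mod `ℓ` (Ribet; Diamond–Taylor) and, in the cell `bsd-wall` (crux Kμ⁺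
stmt-BirchSwinnertonDyer-20689), the hypothesis `hbad` of `…SignedMuVanishingAtTwoPlusOldClassCongruence`.
The companion statement for `p ∤ N` is the tree's `heckeT_iota` / `heckeT_degeneracyMap0` (`T_p` commutes with `ι_d`).

References: A. O. L. Atkin, J. Lehner, *Hecke operators on Γ₀(m)*, Math. Ann. 185 (1970), Lemma 15 [AtkinLehner1970];
F. Diamond, J. Shurman, *A first course in modular forms*, GTM 228, Prop. 5.2.2 (a), §5.7, Prop. 5.8.5 [DiamondShurman2005].
-/

noncomputable section

open scoped MatrixGroups ModularForm

open CongruenceSubgroup ModularFormClass UpperHalfPlane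

namespace Literature.NumberTheory.EllipticCurves.ModularForms

variable {M N : ℕ} [NeZero M] [NeZero N] {k : ℤ}

omit [NeZero M] in
/-- **`U_p` on the old form `ι_d f` when `p ∣ d`**: for a prime `p ∣ N` and `M (d' p) ∣ N`,
`T_p (ι_{d'p} f) = ι_{d'} f` at level `N` (`a_n(T_p h) = a_{pn}(h)` for `p ∣ N` and `a_n(ι_d f) = 𝟙_{d∣n} a_{n/d}(f)`).
[cite: DiamondShurman2005, Prop. 5.2.2 (a) and §5.7] [cite: AtkinLehner1970, Lemma 15] -/
theorem heckeT_iota_of_dvd {p : ℕ} [NeZero p] (hp : p.Prime) (hpN : p ∣ N) {d' : ℕ} [NeZero d']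
    [NeZero (d' * p)] (h : M * (d' * p) ∣ N) (h' : M * d' ∣ N) (f : CuspForm (Gamma0 M) k) :
    heckeT (Gamma0 N) k p (iota M N (d' * p) k h f) = iota M N d' k h' f := by
  rw [← sub_eq_zero]
  refine eq_zero_of_qExpansion_coeff_eq_zero_level0 _ fun n ↦ ?_
  rw [qExpansion_coeff_sub_level0, sub_eq_zero, qExpansion_coeff_heckeT_holds N k _ p hp n, if_pos hpN, add_zero,
    qExpansion_coeff_iota, qExpansion_coeff_iota]
  have hp0 : 0 < p := hp.pos
  by_cases hd : d' ∣ n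
  · obtain ⟨m, rfl⟩ := hd
    rw [if_pos ⟨m, by ring⟩, if_pos (dvd_mul_right d' m), show p * (d' * m) = d' * p * m by ring,
      Nat.mul_div_cancel_left m (NeZero.pos (d' * p)), Nat.mul_div_cancel_left m (NeZero.pos d')]
  · rw [if_neg hd, if_neg]
    rintro ⟨m, hm⟩
    apply hd
    refine ⟨m, ?_⟩
    have : p * n = p * (d' * m) := by rw [hm]; ring
    exact Nat.eq_of_mul_eq_mul_left hp0 this

/-- **`U_p` on the old form `ι_d f` when `p ∤ d`, `p ∣ N`, `p ∤ M`**: for a normalised newform `f` of level `M`,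
`T_p (ι_d f) = a_p(f) ι_d f − p^{k−1} ι_{dp} f` at level `N` (`a_{pm}(f) = a_p a_m − p^{k−1} 𝟙_{p∣m} a_{m/p}` for `p ∤ M`).
[cite: DiamondShurman2005, Prop. 5.2.2 (a), Prop. 5.8.5 and §5.7] [cite: AtkinLehner1970, Lemma 15] -/
theorem heckeT_iota_of_not_dvd_of_not_dvd_level {p : ℕ} [NeZero p] (hp : p.Prime) (hpN : p ∣ N) (hpM : ¬ p ∣ M)
    {d : ℕ} [NeZero d] [NeZero (d * p)] (hpd : ¬ p ∣ d) (h : M * d ∣ N) (h' : M * (d * p) ∣ N)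
    {f : CuspForm (Gamma0 M) k} (hf : IsNewform0 f) :
    heckeT (Gamma0 N) k p (iota M N d k h f) =
      cuspCoeff f p • iota M N d k h f - (p : ℂ) ^ (k - 1) • iota M N (d * p) k h' f := by
  rw [← sub_eq_zero]
  refine eq_zero_of_qExpansion_coeff_eq_zero_level0 _ fun n ↦ ?_
  rw [qExpansion_coeff_sub_level0, sub_eq_zero, qExpansion_coeff_heckeT_holds N k _ p hp n, if_pos hpN, add_zero,
    qExpansion_coeff_sub_level0, qExpansion_coeff_smul, qExpansion_coeff_smul, qExpansion_coeff_iota,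
    qExpansion_coeff_iota, qExpansion_coeff_iota]
  have hp0 : 0 < p := hp.pos
  have hcop : Nat.Coprime d p := (Nat.Coprime.symm ((Nat.Prime.coprime_iff_not_dvd hp).mpr hpd))
  by_cases hd : d ∣ n
  · obtain ⟨m, rfl⟩ := hd
    rw [if_pos (Dvd.dvd.mul_left (dvd_mul_right d m) p), if_pos (dvd_mul_right d m),
      show p * (d * m) = d * (p * m) by ring, Nat.mul_div_cancel_left _ (NeZero.pos d),
      Nat.mul_div_cancel_left _ (NeZero.pos d)]
    have hmul := hf.cuspCoeff_prime_mul hp m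
    rw [if_neg hpM] at hmul
    change (qExpansion 1 ⇑f).coeff (p * m) = (qExpansion 1 ⇑f).coeff p * (qExpansion 1 ⇑f).coeff m -
      (p : ℂ) ^ (k - 1) * (if p ∣ m then (qExpansion 1 ⇑f).coeff (m / p) else 0) at hmul
    rw [hmul]
    by_cases hpm : p ∣ m
    · obtain ⟨r, rfl⟩ := hpm
      rw [if_pos (dvd_mul_right p r), if_pos ⟨r, by ring⟩, Nat.mul_div_cancel_left r hp0,
        show d * (p * r) = d * p * r by ring, Nat.mul_div_cancel_left r (NeZero.pos (d * p))]
      rfl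
    · have hdp : ¬ d * p ∣ d * m := by
        rintro ⟨r, hr⟩
        exact hpm ⟨r, Nat.eq_of_mul_eq_mul_left (NeZero.pos d) (by rw [hr]; ring)⟩
      rw [if_neg hpm, if_neg hdp]
      simp only [mul_zero, sub_zero]
      rfl
  · have hd' : ¬ d ∣ p * n := fun hdpn ↦ hd (hcop.dvd_of_dvd_mul_left hdpn)
    have hd'' : ¬ d * p ∣ n := fun hdn ↦ hd (dvd_trans (dvd_mul_right d p) hdn)
    rw [if_neg hd', if_neg hd, if_neg hd'']
    simp

/-- **`U_p` on the old form `ι_d f` when `p ∣ M` (`p ∤ d`)**: for a normalised newform `f` of level `M`,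
`T_p (ι_d f) = a_p(f) ι_d f` at level `N` (`a_{pm}(f) = a_p(f) a_m(f)` for `p ∣ M`).
[cite: DiamondShurman2005, Prop. 5.2.2 (a), Prop. 5.8.5 and §5.7] [cite: AtkinLehner1970, Lemma 15] -/
theorem heckeT_iota_of_not_dvd_of_dvd_level {p : ℕ} [NeZero p] (hp : p.Prime) (hpN : p ∣ N) (hpM : p ∣ M)
    {d : ℕ} [NeZero d] (hpd : ¬ p ∣ d) (h : M * d ∣ N) {f : CuspForm (Gamma0 M) k} (hf : IsNewform0 f) :
    heckeT (Gamma0 N) k p (iota M N d k h f) = cuspCoeff f p • iota M N d k h f := by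
  rw [← sub_eq_zero]
  refine eq_zero_of_qExpansion_coeff_eq_zero_level0 _ fun n ↦ ?_
  rw [qExpansion_coeff_sub_level0, sub_eq_zero, qExpansion_coeff_heckeT_holds N k _ p hp n, if_pos hpN, add_zero,
    qExpansion_coeff_smul, qExpansion_coeff_iota, qExpansion_coeff_iota]
  have hcop : Nat.Coprime d p := (Nat.Coprime.symm ((Nat.Prime.coprime_iff_not_dvd hp).mpr hpd))
  by_cases hd : d ∣ n
  · obtain ⟨m, rfl⟩ := hd
    rw [if_pos (Dvd.dvd.mul_left (dvd_mul_right d m) p), if_pos (dvd_mul_right d m),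
      show p * (d * m) = d * (p * m) by ring, Nat.mul_div_cancel_left _ (NeZero.pos d),
      Nat.mul_div_cancel_left _ (NeZero.pos d)]
    have hmul := hf.cuspCoeff_prime_mul hp m
    rw [if_pos hpM, sub_zero] at hmul
    exact hmul
  · have hd' : ¬ d ∣ p * n := fun hdpn ↦ hd (hcop.dvd_of_dvd_mul_left hdpn)
    rw [if_neg hd', if_neg hd, mul_zero]

end Literature.NumberTheory.EllipticCurves.ModularForms

end
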